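import Summits.AtomisticToContinuum.Crystallization.Theorems.FrustratedLawDichotomyAperiodicGapRecordJunctionTubeTailS3

/-!
# The core-tube binders of the 27623 junction of record in FRAME-FIXED form: `NearHomAt ρ ε` suffices for `NearHomIsoAt ρ ε`
# (FrustratedLawDichotomy · crux `AperiodicFrustratedLawGap`, stmt-AtomisticToContinuum-27623; decomp-a2c hand 2, generation 38; structural share, DEF-FREE)

The in-tube binders of the junction of record (critic rows 1411 / 1417; `…RecordJunctionTubeTail` §4, `…TubeTailSq`, `…TubeTailS3` §3) — the core-tube floor
`MonoCoreTubeFloor r r₁ ρ ε φ`, the linear-response leaf `CoreCoreRelief r r₁ ρ ε A` (leaf 6), the in-tube far tail (leaf 6′) and the rim piece `RimOffTubeFloor` — are stated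
on clusters whose `ρ`-core is `ε`-near-affine MODULO ISOMETRY (`NearHomIsoAt ρ ε z c := ∃ R : E3 ≃ₗᵢ[ℝ] E3, NearHomAt ρ ε (R ∘ z) c`, `…StrainedPatchCoreTube` §1), because the
admissible homogeneous instances of `IsHomBall` carry a PINNED frame (`fccVec` / `hexFrame`, `‖G − 1‖ ≤ 1/4`).  Every quantity these binders price is invariant under linear
isometries (`…StrainedPatchHomIsometry`, `…HomTubeIso` §1, `…CoreTubeRecord.tailOut_comp`), so — exactly as «HomTubeIso» proved for the g46 record-radius tube
(`tubeFloorIso_iff_tubeFloor`) — each binder is EQUIVALENT to its FRAME-FIXED form, in which the cluster is assumed near-affine IN THE GIVEN FRAME (`NearHomAt ρ ε z c`: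
atom-by-atom within `ε` of an admissible homogeneous instance, positions relative to the centres, no rotation).  That is the form an instrument or a certificate works
in (a perturbation of ONE pinned lattice's window sums; no minimisation over `SO(3)`):

* §1 invariance of the CORE functional and of the far-tail average (`ballAvg_core_comp`, `ballAvg_tailOut_comp`);
* §2 ★ `monoCoreTubeFloor_iff_frameFixed`, ★ `coreCoreRelief_iff_frameFixed`, ★ `tubeTail_iff_frameFixed` (leaf 6′), `rimOffTubeFloor_iff_frameFixed` — generic in every dial;
* §3 ★★★ the junction of record in v3 currency with leaves 6 and 6′ FRAME-FIXED:
  `aperiodicFrustratedLawGap_of_entryTreesHTA2QQDCRS3_of_coreOff_tubeTail_frameFixed` (the other nine leaves literal-unchanged), and the generic-dial form.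

One- to five-line proofs from tree lemmas; 0 sorry; no definitions; no `native_decide`.  `--supports stmt-AtomisticToContinuum-27623`.  [folklore]
-/

noncomputable section

namespace Summit.AtomisticToContinuum.Crystallization.Theorems.FrustratedLawDichotomyStrainedPatchCoreTubeFrame

open scoped BigOperators RealInnerProductSpace
open Literature.Analysis.ValidatedNumerics.Numerics
open Summit.AtomisticToContinuum.Crystallization.Theorems.ChargedEnergyGapNegative (eStar)
open Summit.AtomisticToContinuum.Crystallization.Theorems.FrustratedLawDichotomyRangeCut
open Summit.AtomisticToContinuum.Crystallization.Theorems.FrustratedLawDichotomySchurCut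
open Summit.AtomisticToContinuum.Crystallization.Theorems.FrustratedLawDichotomyMotifLemmas (GoodAtScale)
open Summit.AtomisticToContinuum.Crystallization.Theorems.FrustratedLawDichotomyAveragingCut
open Summit.AtomisticToContinuum.Crystallization.Theorems.FrustratedLawDichotomyAveragingRuleTightFree (TightNearCap BadNearCap)
open Summit.AtomisticToContinuum.Crystallization.Theorems.FrustratedLawDichotomyExemptAbsorption (ExemptNear)
open Summit.AtomisticToContinuum.Crystallization.Theorems.FrustratedLawDichotomyExemptLocOpt (LocOptFails)
open Summit.AtomisticToContinuum.Crystallization.Theorems.FrustratedLawDichotomyExemptSplit (SchurElasticPricingX)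
open Summit.AtomisticToContinuum.Crystallization.Theorems.FrustratedLawDichotomyExemptAbsorptionRecord
open Summit.AtomisticToContinuum.Crystallization.Theorems.FrustratedLawDichotomyCollarCensus
open Summit.AtomisticToContinuum.Crystallization.Theorems.FrustratedLawDichotomyCollarCensusKappa
open Summit.AtomisticToContinuum.Crystallization.Theorems.FrustratedLawDichotomyStrainedPatchHomSplit
open Summit.AtomisticToContinuum.Crystallization.Theorems.FrustratedLawDichotomyStrainedPatchHomIsometry
open Summit.AtomisticToContinuum.Crystallization.Theorems.FrustratedLawDichotomyStrainedPatchHomTube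
open Summit.AtomisticToContinuum.Crystallization.Theorems.FrustratedLawDichotomyStrainedPatchHomTubeIso
open Summit.AtomisticToContinuum.Crystallization.Theorems.FrustratedLawDichotomyStrainedPatchCleanCollar
open Summit.AtomisticToContinuum.Crystallization.Theorems.FrustratedLawDichotomyStrainedPatchPhaseCut
open Summit.AtomisticToContinuum.Crystallization.Theorems.FrustratedLawDichotomyStrainedPatchCoreTube
open Summit.AtomisticToContinuum.Crystallization.Theorems.FrustratedLawDichotomyStrainedPatchCoreTubeRecord
open Summit.AtomisticToContinuum.Crystallization.Theorems.FrustratedLawDichotomyStrainedPatchHomCertTree (CertTree treeOK)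
open Summit.AtomisticToContinuum.Crystallization.Theorems.FrustratedLawDichotomyStrainedPatchHomEntryGram (rootC rootW)
open Summit.AtomisticToContinuum.Crystallization.Theorems.FrustratedLawDichotomyStrainedPatchHomEntryGramHcp (rootCH rootWH)
open Summit.AtomisticToContinuum.Crystallization.Theorems.FrustratedLawDichotomyStrainedPatchHomEntryTable (muRec muRec_ok)
open Summit.AtomisticToContinuum.Crystallization.Theorems.FrustratedLawDichotomyStrainedPatchHomEntryTableP (entryLeafOK6RBKP entryLeafOK6RBKP_sound)
open Summit.AtomisticToContinuum.Crystallization.Theorems.FrustratedLawDichotomyStrainedPatchHomEntryLeafHT (entryLeafOKHT4A2QQDCRS3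
  entryLeafOKHT4A2QQDCRS3_sound)
open Summit.AtomisticToContinuum.Crystallization.Theorems.FrustratedLawDichotomyAperiodicGapRecordJunction
open Summit.AtomisticToContinuum.Crystallization.Theorems.FrustratedLawDichotomyAperiodicGapRecordJunctionVerdict
open Summit.AtomisticToContinuum.Crystallization.Theorems.FrustratedLawDichotomyAperiodicGapRecordJunctionTubeTail
open Summit.AtomisticToContinuum.Crystallization.Theorems.FrustratedLawDichotomyAperiodicGapRecordJunctionTubeTailS3

/-! ## §1 Invariance of the core functional and of the far-tail average under linear isometries -/

/-- The members' far-tail average is isometry-invariant: `tail_ρ(R ∘ z, c) = tail_ρ(z, c)`. [folklore: `tailOut_comp` + `ballAvg_comp`] -/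
theorem ballAvg_tailOut_comp (R : E3 ≃ₗᵢ[ℝ] E3) (ρ : ℝ) {M : ℕ} (z : Fin M → E3) (c : Fin M) :
    ballAvg (9 / 5) (⇑R ∘ z) (tailOut ρ M (⇑R ∘ z) c) c = ballAvg (9 / 5) z (tailOut ρ M z c) c := by
  have h : tailOut ρ M (⇑R ∘ z) c = tailOut ρ M z c := funext fun j => tailOut_comp R z c j
  rw [h, ballAvg_comp]

/-- The members' CORE functional (score minus far tail) is isometry-invariant: `core_ρ(R ∘ z, c) = core_ρ(z, c)`. [folklore: `xRec_comp` + `tailOut_comp` + `ballAvg_comp`] -/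
theorem ballAvg_core_comp (R : E3 ≃ₗᵢ[ℝ] E3) (ρ : ℝ) {M : ℕ} (z : Fin M → E3) (c : Fin M) :
    ballAvg (9 / 5) (⇑R ∘ z) (fun j => xRec M (⇑R ∘ z) j - tailOut ρ M (⇑R ∘ z) c j) c =
      ballAvg (9 / 5) z (fun j => xRec M z j - tailOut ρ M z c j) c := by
  have h : (fun j => xRec M (⇑R ∘ z) j - tailOut ρ M (⇑R ∘ z) c j) = fun j => xRec M z j - tailOut ρ M z c j :=
    funext fun j => by rw [xRec_comp, tailOut_comp]
  rw [h, ballAvg_comp]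

/-! ## §2 ★ The core-tube binders are equivalent to their FRAME-FIXED forms (every dial) -/

/-- ★ **CORE-TUBE FLOOR, FRAME-FIXED**: `MonoCoreTubeFloor r r₁ ρ ε φ ↔` «on admissible clusters clean within `r`, of one word out to `r₁`, whose `ρ`-core is `ε`-near-affine
IN THE GIVEN FRAME (`NearHomAt ρ ε`), the score is `≥ φ`».  (→) `nearHomIsoAt_of_nearHomAt`; (←) rotate the cluster by the isometry of `NearHomIsoAt` — admissibility,
cleanliness, the word and the score are invariant. [folklore] -/
theorem monoCoreTubeFloor_iff_frameFixed (r r₁ ρ ε φ : ℝ) :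
    MonoCoreTubeFloor r r₁ ρ ε φ ↔
      ∀ (M : ℕ) (z : Fin M → E3) (c : Fin M), Admissible M z c → CleanBall r z c → MonoPhaseBall r₁ z c → NearHomAt ρ ε z c →
        φ ≤ ballAvg (9 / 5) z (xRec M z) c := by
  constructor
  · intro h M z c hz hcl hm hn
    exact h M z c hz hcl hm (nearHomIsoAt_of_nearHomAt hn)
  · intro h M z c hz hcl hm hn
    obtain ⟨R, hR⟩ := hn
    have h1 := h M (⇑R ∘ z) c ((admissible_comp_iff R z c).2 hz) ((cleanBall_comp_iff R z c).2 hcl) ((monoPhaseBall_comp_iff R z c).2 hm) hR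
    rwa [ballAvg_xRec_comp] at h1

/-- ★ **LEAF 6 `CoreCoreRelief`, FRAME-FIXED**: `CoreCoreRelief r r₁ ρ ε A ↔` «for admissible clusters clean within `r`, of one word out to `r₁`, `ε`-near-affine on the `ρ`-core IN
THE GIVEN FRAME, some admissible homogeneous instance has core value at most `A` above the cluster's».  (←) the core functional is isometry-invariant (`ballAvg_core_comp`) and
the comparison instance needs no rotation. [folklore] -/
theorem coreCoreRelief_iff_frameFixed (r r₁ ρ ε A : ℝ) :
    CoreCoreRelief r r₁ ρ ε A ↔
      ∀ (M : ℕ) (z : Fin M → E3) (c : Fin M), Admissible M z c → CleanBall r z c → MonoPhaseBall r₁ z c → NearHomAt ρ ε z c →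
        ∃ (M₀ : ℕ) (z₀ : Fin M₀ → E3) (c₀ : Fin M₀), Admissible M₀ z₀ c₀ ∧ IsHomBall (133 / 10) z₀ c₀ ∧
          ballAvg (9 / 5) z₀ (fun j => xRec M₀ z₀ j - tailOut ρ M₀ z₀ c₀ j) c₀ - A ≤
            ballAvg (9 / 5) z (fun j => xRec M z j - tailOut ρ M z c j) c := by
  constructor
  · intro h M z c hz hcl hm hn
    exact h M z c hz hcl hm (nearHomIsoAt_of_nearHomAt hn)
  · intro h M z c hz hcl hm hn
    obtain ⟨R, hR⟩ := hn
    obtain ⟨M₀, z₀, c₀, h₀, hhom, hle⟩ :=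
      h M (⇑R ∘ z) c ((admissible_comp_iff R z c).2 hz) ((cleanBall_comp_iff R z c).2 hcl) ((monoPhaseBall_comp_iff R z c).2 hm) hR
    refine ⟨M₀, z₀, c₀, h₀, hhom, ?_⟩
    rwa [ballAvg_core_comp] at hle

/-- ★ **LEAF 6′ (IN-TUBE FAR TAIL), FRAME-FIXED**: the in-tube tail bound `−μ ≤ tail_ρ` on `CleanBall r ∧ MonoPhaseBall r₁ ∧ NearHomIsoAt ρ ε` clusters `↔` the same bound on
`CleanBall r ∧ MonoPhaseBall r₁ ∧ NearHomAt ρ ε` clusters (the far-tail average is isometry-invariant, `ballAvg_tailOut_comp`). [folklore] -/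
theorem tubeTail_iff_frameFixed (r r₁ ρ ε μ : ℝ) :
    (∀ (M : ℕ) (z : Fin M → E3) (c : Fin M), Admissible M z c → CleanBall r z c → MonoPhaseBall r₁ z c → NearHomIsoAt ρ ε z c →
        -μ ≤ ballAvg (9 / 5) z (tailOut ρ M z c) c) ↔
      ∀ (M : ℕ) (z : Fin M → E3) (c : Fin M), Admissible M z c → CleanBall r z c → MonoPhaseBall r₁ z c → NearHomAt ρ ε z c →
        -μ ≤ ballAvg (9 / 5) z (tailOut ρ M z c) c := by
  constructor
  · intro h M z c hz hcl hm hn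
    exact h M z c hz hcl hm (nearHomIsoAt_of_nearHomAt hn)
  · intro h M z c hz hcl hm hn
    obtain ⟨R, hR⟩ := hn
    have h1 := h M (⇑R ∘ z) c ((admissible_comp_iff R z c).2 hz) ((cleanBall_comp_iff R z c).2 hcl) ((monoPhaseBall_comp_iff R z c).2 hm) hR
    rwa [ballAvg_tailOut_comp] at h1

/-- **RIM PIECE, FRAME-FIXED on its positive clause**: `RimOffTubeFloor r r₁ ρ ε ρ′ ε′ φ ↔` the same with `NearHomAt ρ ε` in place of `NearHomIsoAt ρ ε` (the negative clause
`¬NearHomIsoAt ρ′ ε′` is itself isometry-invariant, `nearHomIsoAt_comp_iff`). [folklore] -/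
theorem rimOffTubeFloor_iff_frameFixed (r r₁ ρ ε ρ' ε' φ : ℝ) :
    RimOffTubeFloor r r₁ ρ ε ρ' ε' φ ↔
      ∀ (M : ℕ) (z : Fin M → E3) (c : Fin M), Admissible M z c → CleanBall r z c → MonoPhaseBall r₁ z c → NearHomAt ρ ε z c →
        ¬NearHomIsoAt ρ' ε' z c → φ ≤ ballAvg (9 / 5) z (xRec M z) c := by
  constructor
  · intro h M z c hz hcl hm hn hfar
    exact h M z c hz hcl hm (nearHomIsoAt_of_nearHomAt hn) hfar
  · intro h M z c hz hcl hm hn hfar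
    obtain ⟨R, hR⟩ := hn
    have h1 := h M (⇑R ∘ z) c ((admissible_comp_iff R z c).2 hz) ((cleanBall_comp_iff R z c).2 hcl) ((monoPhaseBall_comp_iff R z c).2 hm) hR
      ((nearHomIsoAt_comp_iff R z c).not.2 hfar)
    rwa [ballAvg_xRec_comp] at h1

/-- The [CORE-FAR] residual needs no frame: `¬NearHomIsoAt ρ ε z c ↔ ∀ R, ¬NearHomAt ρ ε (R ∘ z) c` (far from the tube in EVERY frame). [formal bookkeeping] -/
theorem not_nearHomIsoAt_iff_forall_frames (ρ ε : ℝ) {M : ℕ} (z : Fin M → E3) (c : Fin M) :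
    ¬NearHomIsoAt ρ ε z c ↔ ∀ R : E3 ≃ₗᵢ[ℝ] E3, ¬NearHomAt ρ ε (⇑R ∘ z) c := by
  simp only [NearHomIsoAt, not_exists]

/-! ## §3 ★★★ The junction of record (v3 currency) with leaves 6 and 6′ FRAME-FIXED -/

/-- ★★★ **27623 FROM ELEVEN OPEN LEAVES, v3 currency, leaves 6 (`CoreCoreRelief`) and 6′ (in-tube tail) FRAME-FIXED, STANDARD AXIOMS**: the junction of record
`…TubeTailS3.aperiodicFrustratedLawGap_of_entryTreesHTA2QQDCRS3_of_coreOff_tubeTail_free` with `NearHomAt (24/5) (1/100) z c` (near-affine in the GIVEN frame) in place of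
`NearHomIsoAt (24/5) (1/100) z c` in BOTH in-tube leaves — the other nine leaves literal-unchanged (`0 ≤ D_X`, Eopt-raw, fcc/hcp ∃-trees, [CORE-FAR] `0`, phase floors `1/1000`,
defect pieces, CC∪T₀, DD∪T₀). [folklore instantiation: §2 (←) directions] -/
theorem aperiodicFrustratedLawGap_of_entryTreesHTA2QQDCRS3_of_coreOff_tubeTail_frameFixed {εE CE DE DX : ℝ}
    (hε0 : 0 < εE) (hε1 : εE ≤ 1 / 10000) (hDX : 0 ≤ DX)
    (hE : SchurElasticPricingX (1 / 20) (1 / 8) w₄₅ ω₄ (3 / 400) (-(7175 / 10000)) (1 / 10000) CE DE DX (LocOptFails eStar εE (3 / 2) 1))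
    (hFcc : ∃ t : CertTree (Fin 3 × Fin 3), treeOK (entryLeafOK6RBKP muRec) t rootC rootW = true)
    (hHcp : ∃ t : CertTree ((Fin 3 × Fin 3) ⊕ Fin 3), treeOK (entryLeafOKHT4A2QQDCRS3 muRec) t rootCH rootWH = true)
    (hT : ∀ (M : ℕ) (z : Fin M → E3) (c : Fin M), Admissible M z c → CleanBall (63 / 10) z c → MonoPhaseBall (63 / 10) z c →
      NearHomAt (24 / 5) (1 / 100) z c → -(1 / 1000) ≤ ballAvg (9 / 5) z (tailOut (24 / 5) M z c) c)
    (hRl : ∀ (M : ℕ) (z : Fin M → E3) (c : Fin M), Admissible M z c → CleanBall (63 / 10) z c → MonoPhaseBall (63 / 10) z c →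
      NearHomAt (24 / 5) (1 / 100) z c →
        ∃ (M₀ : ℕ) (z₀ : Fin M₀ → E3) (c₀ : Fin M₀), Admissible M₀ z₀ c₀ ∧ IsHomBall (133 / 10) z₀ c₀ ∧
          ballAvg (9 / 5) z₀ (fun j => xRec M₀ z₀ j - tailOut (24 / 5) M₀ z₀ c₀ j) c₀ - 3 / 5000 ≤
            ballAvg (9 / 5) z (fun j => xRec M z j - tailOut (24 / 5) M z c j) c)
    (hC : CoreOffTubeFloor (63 / 10) (63 / 10) (24 / 5) (1 / 100) 0) (hF : AnnularPhaseFloor (63 / 10) (24 / 5) (63 / 10) (1 / 1000))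
    (hP : PolyTextureFloor (63 / 10) (24 / 5) (1 / 1000)) (hA : AnnularDefectFloor (24 / 5) (63 / 10)) (hD : DefectiveCollarFloor (24 / 5))
    (h2 : CrowdedCoreMotifPricingCapK (1 / 1000) (9 / 5) (133 / 10) (3 / 2) (effPot w₄₅ ω₄ (3 / 400)) (-(7175 / 10000) + 3 / 400)
      (Collar (9 / 2) fun N y j => (∃ s : ℝ, 0 ≤ s ∧ s ≤ 3 / 2 ∧ NonEquilibriumCore (-(7175 / 10000)) 0 7 s (1 / 10000) N y j) ∨
        GoodAtScale (1 / 20) (3 / 2) y j))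
    (h3 : DiluteDefectMotifPricingCapK (1 / 1000) (9 / 5) (133 / 10) (3 / 2) (effPot w₄₅ ω₄ (3 / 400)) (-(7175 / 10000) + 3 / 400)
      (Collar (9 / 2) fun N y j => (∃ s : ℝ, 0 ≤ s ∧ s ≤ 3 / 2 ∧ NonEquilibriumCore (-(7175 / 10000)) 0 7 s (1 / 10000) N y j) ∨
        GoodAtScale (1 / 20) (3 / 2) y j)) :
    Summit.AtomisticToContinuum.Crystallization.Theses.FrustratedLawDichotomy.AperiodicFrustratedLawGap :=
  aperiodicFrustratedLawGap_of_entryTreesHTA2QQDCRS3_of_coreOff_tubeTail_free hε0 hε1 hDX hE hFcc hHcp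
    ((tubeTail_iff_frameFixed (63 / 10) (63 / 10) (24 / 5) (1 / 100) (1 / 1000)).2 hT)
    ((coreCoreRelief_iff_frameFixed (63 / 10) (63 / 10) (24 / 5) (1 / 100) (3 / 5000)).2 hRl) hC hF hP hA hD h2 h3

/-- ★★ **The v3 DIAL SHEET with leaves 6 and 6′ frame-fixed** (`ρ ≥ 17/5`, `ε`, `A`, `μT`, `φᵢ` free; seam `A + μT ≤ 1/625`). [folklore instantiation] -/
theorem aperiodicFrustratedLawGap_of_entryTreesHTA2QQDCRS3_of_coreOff_tubeTail_dial_frameFixed {ρ ε μT A φ₁ φ₂ φ₃ εE CE DE DX : ℝ}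
    (hε0 : 0 < εE) (hε1 : εE ≤ 1 / 10000) (hDX : 0 ≤ DX)
    (hE : SchurElasticPricingX (1 / 20) (1 / 8) w₄₅ ω₄ (3 / 400) (-(7175 / 10000)) (1 / 10000) CE DE DX (LocOptFails eStar εE (3 / 2) 1))
    (hFcc : ∃ t : CertTree (Fin 3 × Fin 3), treeOK (entryLeafOK6RBKP muRec) t rootC rootW = true)
    (hHcp : ∃ t : CertTree ((Fin 3 × Fin 3) ⊕ Fin 3), treeOK (entryLeafOKHT4A2QQDCRS3 muRec) t rootCH rootWH = true)
    (hρ : 17 / 5 ≤ ρ)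
    (hT : ∀ (M : ℕ) (z : Fin M → E3) (c : Fin M), Admissible M z c → CleanBall (63 / 10) z c → MonoPhaseBall (63 / 10) z c → NearHomAt ρ ε z c →
      -μT ≤ ballAvg (9 / 5) z (tailOut ρ M z c) c)
    (hR : ∀ (M : ℕ) (z : Fin M → E3) (c : Fin M), Admissible M z c → CleanBall (63 / 10) z c → MonoPhaseBall (63 / 10) z c → NearHomAt ρ ε z c →
      ∃ (M₀ : ℕ) (z₀ : Fin M₀ → E3) (c₀ : Fin M₀), Admissible M₀ z₀ c₀ ∧ IsHomBall (133 / 10) z₀ c₀ ∧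
        ballAvg (9 / 5) z₀ (fun j => xRec M₀ z₀ j - tailOut ρ M₀ z₀ c₀ j) c₀ - A ≤ ballAvg (9 / 5) z (fun j => xRec M z j - tailOut ρ M z c j) c)
    (hm : A + μT ≤ 1 / 625)
    (hC : CoreOffTubeFloor (63 / 10) (63 / 10) ρ ε φ₁) (hF : AnnularPhaseFloor (63 / 10) (24 / 5) (63 / 10) φ₂)
    (hP : PolyTextureFloor (63 / 10) (24 / 5) φ₃) (h₁ : 0 ≤ φ₁) (h₂ : 0 ≤ φ₂) (h₃ : 0 ≤ φ₃) (hA : AnnularDefectFloor (24 / 5) (63 / 10))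
    (hD : DefectiveCollarFloor (24 / 5))
    (h2 : CrowdedCoreMotifPricingCapK (1 / 1000) (9 / 5) (133 / 10) (3 / 2) (effPot w₄₅ ω₄ (3 / 400)) (-(7175 / 10000) + 3 / 400)
      (Collar (9 / 2) fun N y j => (∃ s : ℝ, 0 ≤ s ∧ s ≤ 3 / 2 ∧ NonEquilibriumCore (-(7175 / 10000)) 0 7 s (1 / 10000) N y j) ∨
        GoodAtScale (1 / 20) (3 / 2) y j))
    (h3 : DiluteDefectMotifPricingCapK (1 / 1000) (9 / 5) (133 / 10) (3 / 2) (effPot w₄₅ ω₄ (3 / 400)) (-(7175 / 10000) + 3 / 400)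
      (Collar (9 / 2) fun N y j => (∃ s : ℝ, 0 ≤ s ∧ s ≤ 3 / 2 ∧ NonEquilibriumCore (-(7175 / 10000)) 0 7 s (1 / 10000) N y j) ∨
        GoodAtScale (1 / 20) (3 / 2) y j)) :
    Summit.AtomisticToContinuum.Crystallization.Theses.FrustratedLawDichotomy.AperiodicFrustratedLawGap :=
  aperiodicFrustratedLawGap_of_entryTreesHTA2QQDCRS3_of_coreOff_tubeTail_dial hε0 hε1 hDX hE hFcc hHcp hρ
    ((tubeTail_iff_frameFixed (63 / 10) (63 / 10) ρ ε μT).2 hT) ((coreCoreRelief_iff_frameFixed (63 / 10) (63 / 10) ρ ε A).2 hR) hm hC hF hP h₁ h₂ h₃ hA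
    hD h2 h3

end Summit.AtomisticToContinuum.Crystallization.Theorems.FrustratedLawDichotomyStrainedPatchCoreTubeFrame

end
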